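import Mathlib
import Summits.Ventures.PercRepro.TriangleCapCherryPairs

/-!
# PercRepro — the star rows `m ≤ k − 1` of the cherry table are solved exactly: the maximum is `C(m, 2)`,
attained by the star (p3, gen 29)

`cherries_le_choose_two` (TriangleCapCherryPairs) bounds `Σ_v C(d(v), 2)` by `C(m, 2)` on every finite simple
graph with `m` edges.  This module shows the bound is attained by a `K₄⁻`-free graph whenever a star with `m`
leaves fits, i.e. for `m ≤ k − 1`: the star `star k m` on `Fin k` with leaves `0, …, m − 1` and centre `m`.
Hence the `K₄⁻`-free cherry maximum at `(k, m)` with `m ≤ k − 1` is EXACTLY `C(m, 2)` — the `30` star rows of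
the engine's `k ≤ 9` census table (P3-TRIANGLE-CAP.md §10x(f), INBOX 12184) as one theorem for every `k`.

* `star k m : SimpleGraph (Fin k)` — `i ~ j` iff one of them is the centre `m` and the other a leaf `< m`;
* `k4mFree_star` — every adjacent ordered pair has the centre in it, so a `4`-set carries `≤ 2 · 1 · 4 = 8`;
* `deg_star_centre = m` (`Fin.card_filter_val_lt`), `deg_star_le_one` off the centre, `sum_deg_star = 2m`,
  `card_edges_star = m` (handshake), `cherries_star = C(m, 2)` (only the centre contributes);
* **`exists_k4mFree_cherries_eq_choose_two`** — for `m + 1 ≤ k` a `K₄⁻`-free graph on `Fin k` with `m` edges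
  and `C(m, 2)` cherries;
* **`cherries_le_choose_two_of_k4mFree`** (the bound restated on the class) and **`star_rows_exact`** — the
  maximum over `K₄⁻`-free graphs on `Fin k` with `m ≤ k − 1` edges is `C(m, 2)`: an upper bound for every such
  graph and a graph attaining it.

Axioms: standard.
-/

namespace PercRepro

namespace TriangleCap

namespace C047

open Finset

/-- The star on `Fin k` with leaves `0, …, m − 1` and centre `m` (a graph for every `k`, `m`; it has `m` edges
exactly when the centre exists, `m < k`). -/
def star (k m : ℕ) : SimpleGraph (Fin k) where
  Adj i j := (i.val = m ∧ j.val < m) ∨ (j.val = m ∧ i.val < m)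
  symm := ⟨fun i j h => by
    rcases h with ⟨h1, h2⟩ | ⟨h1, h2⟩
    · exact Or.inr ⟨h1, h2⟩
    · exact Or.inl ⟨h1, h2⟩⟩
  loopless := ⟨fun i h => by
    rcases h with ⟨h1, h2⟩ | ⟨h1, h2⟩ <;> omega⟩

/-- Adjacency in the star is decidable. -/
instance decidableRelStar (k m : ℕ) : DecidableRel (star k m).Adj :=
  fun i j => inferInstanceAs (Decidable ((i.val = m ∧ j.val < m) ∨ (j.val = m ∧ i.val < m)))

/-- `(star k m).Adj i j ↔ (i = m ∧ j < m) ∨ (j = m ∧ i < m)`. -/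
theorem star_adj (k m : ℕ) (i j : Fin k) :
    (star k m).Adj i j ↔ (i.val = m ∧ j.val < m) ∨ (j.val = m ∧ i.val < m) := Iff.rfl

/-- At most one vertex of a set has value `m`. -/
theorem card_filter_val_eq_le_one (k m : ℕ) (S : Finset (Fin k)) :
    (S.filter (fun i : Fin k => i.val = m)).card ≤ 1 := by
  rw [card_le_one]
  intro a ha b hb
  rw [mem_filter] at ha hb
  exact Fin.ext (ha.2.trans hb.2.symm)

/-- The adjacent ordered pairs inside `S` have the centre as a coordinate: `≤ 2 · 1 · |S|` of them. -/
theorem adjPairs_star_le (k m : ℕ) (S : Finset (Fin k)) : adjPairs (star k m) S ≤ 2 * S.card := by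
  unfold adjPairs
  set C := S.filter (fun i : Fin k => i.val = m) with hC
  have hsub : (S ×ˢ S).filter (fun p => (star k m).Adj p.1 p.2) ⊆ C ×ˢ S ∪ S ×ˢ C := by
    intro p hp
    rw [mem_filter, mem_product] at hp
    obtain ⟨⟨h1, h2⟩, hadj⟩ := hp
    rw [star_adj] at hadj
    rw [mem_union, mem_product, mem_product, hC, mem_filter, mem_filter]
    rcases hadj with ⟨hc, _⟩ | ⟨hc, _⟩
    · exact Or.inl ⟨⟨h1, hc⟩, h2⟩
    · exact Or.inr ⟨h1, ⟨h2, hc⟩⟩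
  have hC1 : C.card ≤ 1 := card_filter_val_eq_le_one k m S
  calc ((S ×ˢ S).filter (fun p => (star k m).Adj p.1 p.2)).card
      ≤ (C ×ˢ S ∪ S ×ˢ C).card := card_le_card hsub
    _ ≤ (C ×ˢ S).card + (S ×ˢ C).card := card_union_le _ _
    _ = C.card * S.card + S.card * C.card := by rw [card_product, card_product]
    _ ≤ 1 * S.card + S.card * 1 := by gcongr
    _ = 2 * S.card := by ring

/-- The star is `K₄⁻`-free. -/
theorem k4mFree_star (k m : ℕ) : K4mFree (star k m) := by
  intro S hS
  have h := adjPairs_star_le k m S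
  omega

/-- The neighbours of the centre are the leaves. -/
theorem filter_adj_star_centre (k m : ℕ) (c : Fin k) (hc : c.val = m) :
    univ.filter (fun w => (star k m).Adj c w) = univ.filter (fun i : Fin k => i.val < m) := by
  apply filter_congr
  intro w _
  rw [star_adj]
  constructor
  · rintro (⟨_, h2⟩ | ⟨h1, h2⟩)
    · exact h2
    · omega
  · intro hw
    exact Or.inl ⟨hc, hw⟩

/-- The centre has degree `m` when it exists (`m < k`). -/
theorem deg_star_centre (k m : ℕ) (c : Fin k) (hc : c.val = m) : deg (star k m) c = m := by
  unfold deg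
  rw [filter_adj_star_centre k m c hc]
  have := Fin.card_filter_val_lt (n := k) (m := m)
  rw [this]
  exact Nat.min_eq_right (by omega)

/-- The neighbours of a non-centre vertex lie in the singleton of the centre. -/
theorem filter_adj_star_subset (k m : ℕ) (v : Fin k) (hv : v.val ≠ m) :
    univ.filter (fun w => (star k m).Adj v w) ⊆ univ.filter (fun i : Fin k => i.val = m) := by
  intro w hw
  rw [mem_filter, star_adj] at hw
  rw [mem_filter]
  rcases hw.2 with ⟨h1, _⟩ | ⟨h1, _⟩
  · exact absurd h1 hv
  · exact ⟨mem_univ _, h1⟩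

/-- Off the centre every degree is `≤ 1`. -/
theorem deg_star_le_one (k m : ℕ) (v : Fin k) (hv : v.val ≠ m) : deg (star k m) v ≤ 1 :=
  (card_le_card (filter_adj_star_subset k m v hv)).trans (card_filter_val_eq_le_one k m univ)

/-- A leaf (`v < m`) has degree exactly `1` when the centre exists. -/
theorem deg_star_leaf (k m : ℕ) (hm : m < k) (v : Fin k) (hv : v.val < m) : deg (star k m) v = 1 := by
  have hle := deg_star_le_one k m v (by omega)
  have hpos : 1 ≤ deg (star k m) v := by
    unfold deg
    rw [Nat.one_le_iff_ne_zero, ← pos_iff_ne_zero, card_pos]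
    exact ⟨⟨m, hm⟩, by rw [mem_filter, star_adj]; exact ⟨mem_univ _, Or.inr ⟨rfl, hv⟩⟩⟩
  omega

/-- A vertex beyond the centre (`v > m`) is isolated. -/
theorem deg_star_far (k m : ℕ) (v : Fin k) (hv : m < v.val) : deg (star k m) v = 0 := by
  unfold deg
  rw [card_eq_zero, filter_eq_empty_iff]
  intro w _
  rw [star_adj]
  omega

/-- `Σ_v C(d(v), 2) = C(m, 2)` on the star: only the centre contributes. -/
theorem cherries_star (k m : ℕ) (hm : m < k) : cherries (star k m) = m.choose 2 := by
  unfold cherries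
  rw [sum_eq_single (⟨m, hm⟩ : Fin k)]
  · rw [deg_star_centre k m ⟨m, hm⟩ rfl]
  · intro v _ hv
    have hv' : v.val ≠ m := fun h => hv (Fin.ext h)
    have := deg_star_le_one k m v hv'
    interval_cases (deg (star k m) v) <;> rfl
  · intro h
    exact absurd (mem_univ _) h

/-- `Σ_v d(v) = 2m` on the star. -/
theorem sum_deg_star (k m : ℕ) (hm : m < k) : ∑ v, deg (star k m) v = 2 * m := by
  rw [← sum_filter_add_sum_filter_not univ (fun i : Fin k => i.val < m)]
  have hL : ∑ v ∈ univ.filter (fun i : Fin k => i.val < m), deg (star k m) v =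
      ∑ v ∈ univ.filter (fun i : Fin k => i.val < m), 1 :=
    sum_congr rfl (fun v hv => deg_star_leaf k m hm v (mem_filter.mp hv).2)
  have hR : ∑ v ∈ univ.filter (fun i : Fin k => ¬ i.val < m), deg (star k m) v = m := by
    rw [sum_eq_single (⟨m, hm⟩ : Fin k)]
    · exact deg_star_centre k m ⟨m, hm⟩ rfl
    · intro v hv hne
      obtain ⟨_, hv2⟩ := mem_filter.mp hv
      have hv' : m < v.val := by
        rcases Nat.lt_or_ge m v.val with h | h
        · exact h
        · exact absurd (Fin.ext (show v.val = m by omega)) hne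
      exact deg_star_far k m v hv'
    · intro h
      exact absurd (by rw [mem_filter]; exact ⟨mem_univ _, by simp⟩) h
  rw [hL, hR, sum_const, smul_eq_mul, mul_one]
  have := Fin.card_filter_val_lt (n := k) (m := m)
  rw [this, Nat.min_eq_right (by omega)]
  ring

/-- The star has `m` edges (handshake). -/
theorem card_edges_star (k m : ℕ) (hm : m < k) : (star k m).edgeFinset.card = m := by
  have h := sum_deg_eq (star k m)
  rw [sum_deg_star k m hm] at h
  omega

/-- **THE STAR ROWS ARE ATTAINED:** for `m + 1 ≤ k` a `K₄⁻`-free graph on `Fin k` with `m` edges and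
`Σ_v C(d(v), 2) = C(m, 2)`. -/
theorem exists_k4mFree_cherries_eq_choose_two (k m : ℕ) (hm : m + 1 ≤ k) :
    ∃ (D : SimpleGraph (Fin k)) (_ : DecidableRel D.Adj),
      K4mFree D ∧ D.edgeFinset.card = m ∧ cherries D = m.choose 2 :=
  ⟨star k m, inferInstance, k4mFree_star k m, card_edges_star k m (by omega),
    cherries_star k m (by omega)⟩

/-- The pair count on the row's class (every `K₄⁻`-free graph on `Fin k`). -/
theorem cherries_le_choose_two_of_k4mFree (k : ℕ) (D : SimpleGraph (Fin k)) [DecidableRel D.Adj]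
    (_ : K4mFree D) : cherries D ≤ (D.edgeFinset.card).choose 2 :=
  cherries_le_choose_two D

/-- **THE STAR ROWS `m ≤ k − 1` ARE SOLVED EXACTLY:** every `K₄⁻`-free graph on `Fin k` with `m` edges has
`Σ_v C(d(v), 2) ≤ C(m, 2)`, and the star attains `C(m, 2)`. -/
theorem star_rows_exact (k m : ℕ) (hm : m + 1 ≤ k) :
    (∀ (D : SimpleGraph (Fin k)) [DecidableRel D.Adj], K4mFree D → D.edgeFinset.card = m →
        cherries D ≤ m.choose 2) ∧
      ∃ (D : SimpleGraph (Fin k)) (_ : DecidableRel D.Adj),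
        K4mFree D ∧ D.edgeFinset.card = m ∧ cherries D = m.choose 2 :=
  ⟨fun D _ _ hD => hD ▸ cherries_le_choose_two D, exists_k4mFree_cherries_eq_choose_two k m hm⟩

end C047

end TriangleCap

end PercRepro
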